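import Summits.ResolutionOfSingularities.ResolutionOfSingularities.Theorems.FrobeniusLadderFInjectiveMacaulayficationFilteredReesTwist
import Summits.ResolutionOfSingularities.ResolutionOfSingularities.Theorems.FrobeniusLadderFInjectiveMacaulayficationFilteredReesFibre
import Mathlib.RingTheory.Localization.Ideal
import Mathlib.RingTheory.Localization.Away.AdjoinRoot
import Mathlib.RingTheory.Polynomial.Quotient
import Mathlib.Algebra.MvPolynomial.Equiv
import Mathlib.Algebra.Ring.Hom.InjSurj
import Mathlib.Algebra.CharP.Algebra
import HarnessLib

/-!
# (F4b) `ℛ = k[X,s]/(f^h)` and `T′♮ = ℛ[1/x̄_v^c]` are DOMAINS of characteristic `p`, of finite type, with `s̄ ≠ 0`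
# (crux `FInjectiveMacaulayfication`, line `graded-engine` §17 filtered engine G4♮ — CRUX-PLAN v5 §1.3 piece (F4), second half, part 2)

Support file for crux stmt-ResolutionOfSingularities-15315 (`FrobeniusLadder.FInjectiveMacaulayfication`), chain w45a,
seat res-L1-w45a-stub-3 (owner of (F0)/(F4)/(F5)). [OURS · L1 W4.5a] — NOT a statement of the manuscript; AI-written, weaker than
expert review.

Carrier ((F0) `FilteredReesCarrier`): `A = MvPolynomial (Option (Fin n)) k`, `s = X none`, `hfh : fh = Σ_b c_b X^b s^{w·b − D}`,
`ℛ = A ⧸ (fh)`, `T′♮ = Localization.Away (x̄_v^c)`; hypotheses as in G4♮ (`hD0`, `f₀ ≠ 0`, `(f)` prime, `x̄ⱼ ≠ 0 mod f`).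
The instances that `GradedChartClauseAssembly.chartClause_core_affine` (B := T′♮) and `ConeFibreClause.coneFibreClause` (T := T′♮)
ask for:

* `optionEquivLeft_rename` (`k[X,s] ≅ k[X][s]` sends `rename some g ↦ C g`), `isDomain_quotient_rename` (`A/(f) ≅ (k[X]/(f))[s]` is a
  domain), `X_none_notMem_span_rename` (`s ∉ (f)`);
* `isDomain_away_quotient_fh` — `Aₛ/(f^h)` is a domain: it is `≅ Aₛ/(f)` by the twist ((F4b part 1)), and `Aₛ/(f)` is a
  localisation of the domain `A/(f)` (Mathlib: `S ⧸ I·S` is the localisation of `R ⧸ I`);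
* `mk_X_none_mem_nonZeroDivisors` — **`s̄` is a non-zero-divisor of `ℛ`** (`s a = f^h b` ⇒ `f₀ · b|_{s=0} = 0` ⇒ `s ∣ b` ⇒ `a ∈ (f^h)`);
* `isDomain_rees` — **`ℛ` is a domain** (`ℛ ↪ Aₛ/(f^h)` by the previous item); `mk_X_some_ne_zero`, `mk_X_none_ne_zero`, `fh_not_isUnit`;
* `isDomain_reesAway`, `algebraMap_mk_X_none_ne_zero` — **`T′♮` is a domain and `s̄/1 ≠ 0`**; `charP_reesAway`, `finiteType_reesAway`.

All proofs are glue on Mathlib and (F0)/(F4a)/(F4b part 1); no definitions, no named facts. [folklore]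
-/

-- single-problem summit: the doubled namespace component is forced
set_option linter.dupNamespace false

noncomputable section

namespace Summit.ResolutionOfSingularities.ResolutionOfSingularities.Theorems.FInjectiveMacaulayfication.FilteredReesDomain

open Summit.ResolutionOfSingularities.ResolutionOfSingularities.Theorems.FInjectiveMacaulayfication

variable {k : Type} [Field k] {n : ℕ}

/-! ## `A/(f) ≅ (k[X]/(f))[s]` is a domain not containing `s̄ = 0` -/

/-- `optionEquivLeft` sends `rename some g` to the constant polynomial `C g`. [folklore] -/
theorem optionEquivLeft_rename (g : MvPolynomial (Fin n) k) :
    MvPolynomial.optionEquivLeft k (Fin n) (MvPolynomial.rename some g) = Polynomial.C g := by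
  have h : ((MvPolynomial.optionEquivLeft k (Fin n)).toAlgHom.comp (MvPolynomial.rename some)) g =
      (Polynomial.CAlgHom.comp (AlgHom.id k (MvPolynomial (Fin n) k))) g := by
    congr 1
    refine MvPolynomial.algHom_ext fun j => ?_
    simp [MvPolynomial.optionEquivLeft_X_some]
  simpa using h

/-- **`A/(f)` (with `f` embedded as `rename some f`) is a domain** for `(f)` prime: it is `≅ (k[X]/(f))[s]`. [folklore] -/
theorem isDomain_quotient_rename (f : MvPolynomial (Fin n) k) (hfprime : (Ideal.span {f}).IsPrime) :
    IsDomain (MvPolynomial (Option (Fin n)) k ⧸ Ideal.span {MvPolynomial.rename some f}) := by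
  haveI : IsDomain (MvPolynomial (Fin n) k ⧸ Ideal.span {f}) := Ideal.Quotient.isDomain _
  -- `A/(rename some f) ≅ k[X][s]/(C f) ≅ (k[X]/(f))[s]`
  have e₁ : (MvPolynomial (Option (Fin n)) k ⧸ Ideal.span {MvPolynomial.rename some f}) ≃+*
      Polynomial (MvPolynomial (Fin n) k) ⧸ Ideal.span {Polynomial.C f} :=
    Ideal.quotientEquiv _ _ (MvPolynomial.optionEquivLeft k (Fin n)).toRingEquiv (by
      rw [Ideal.map_span, Set.image_singleton]
      exact congrArg _ (congrArg _ (optionEquivLeft_rename f).symm))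
  have e₂ : Polynomial (MvPolynomial (Fin n) k ⧸ Ideal.span {f}) ≃+*
      Polynomial (MvPolynomial (Fin n) k) ⧸ Ideal.span {Polynomial.C f} := by
    have h : (Ideal.span {f}).map (Polynomial.C : MvPolynomial (Fin n) k →+* _) = Ideal.span {Polynomial.C f} := by
      rw [Ideal.map_span, Set.image_singleton]
    exact (Ideal.polynomialQuotientEquivQuotientPolynomial (Ideal.span {f})).trans (Ideal.quotEquivOfEq h)
  exact (MulEquiv.isDomain_iff (e₁.trans e₂.symm).toMulEquiv).mpr inferInstance

/-- `s ∉ (f)·A`: a constant `C f` with `f` a non-unit does not divide the variable. [folklore] -/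
theorem X_none_notMem_span_rename (f : MvPolynomial (Fin n) k) (hfprime : (Ideal.span {f}).IsPrime) :
    (MvPolynomial.X none : MvPolynomial (Option (Fin n)) k) ∉ Ideal.span {MvPolynomial.rename some f} := by
  intro h
  obtain ⟨q, hq⟩ := Ideal.mem_span_singleton'.mp h
  have h1 := congrArg (MvPolynomial.optionEquivLeft k (Fin n)) hq
  rw [map_mul, optionEquivLeft_rename, MvPolynomial.optionEquivLeft_X_none] at h1
  have h2 : Polynomial.C f ∣ (Polynomial.X : Polynomial (MvPolynomial (Fin n) k)) := ⟨_, by rw [mul_comm]; exact h1.symm⟩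
  rw [Polynomial.C_dvd_iff_dvd_coeff] at h2
  have h3 := h2 1
  rw [Polynomial.coeff_X_one] at h3
  exact hfprime.ne_top (Ideal.eq_top_of_isUnit_mem _ (Ideal.mem_span_singleton_self f) (isUnit_of_dvd_one h3))

/-! ## `Aₛ/(f^h)` is a domain -/

/-- **`Aₛ/(f^h)·Aₛ` is a domain** (`Aₛ = A[1/s]`): by the twist it is `≅ Aₛ/(f)·Aₛ`, a localisation of the domain `A/(f)` at the
powers of `s̄ ≠ 0`. [folklore] -/
theorem isDomain_away_quotient_fh (w : Fin n → ℕ) (D : ℕ) (f : MvPolynomial (Fin n) k) (fh : MvPolynomial (Option (Fin n)) k)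
    (hfh : fh = ∑ b ∈ f.support, MvPolynomial.monomial
      (Finsupp.mapDomain some b + Finsupp.single none (Finsupp.weight w b - D)) (MvPolynomial.coeff b f))
    (hD0 : ∀ m < D, MvPolynomial.weightedHomogeneousComponent w m f = 0) (hfprime : (Ideal.span {f}).IsPrime) :
    IsDomain (Localization.Away (MvPolynomial.X none : MvPolynomial (Option (Fin n)) k) ⧸ (Ideal.span {fh}).map (algebraMap (MvPolynomial (Option (Fin n)) k) (Localization.Away (MvPolynomial.X none : MvPolynomial (Option (Fin n)) k)))) := by
  -- `Aₛ/(f)·Aₛ` is a domain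
  haveI := isDomain_quotient_rename f hfprime
  have hs : (Ideal.Quotient.mk (Ideal.span {MvPolynomial.rename some f}) (MvPolynomial.X none : MvPolynomial (Option (Fin n)) k)) ≠ 0 := fun h =>
    X_none_notMem_span_rename f hfprime (Ideal.Quotient.eq_zero_iff_mem.mp h)
  have hM : Algebra.algebraMapSubmonoid (MvPolynomial (Option (Fin n)) k ⧸ Ideal.span {MvPolynomial.rename some f})
      (Submonoid.powers (MvPolynomial.X none : MvPolynomial (Option (Fin n)) k)) ≤
      nonZeroDivisors (MvPolynomial (Option (Fin n)) k ⧸ Ideal.span {MvPolynomial.rename some f}) := by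
    rw [Algebra.algebraMapSubmonoid_powers]
    exact powers_le_nonZeroDivisors_of_noZeroDivisors hs
  haveI hdom : IsDomain (Localization.Away (MvPolynomial.X none : MvPolynomial (Option (Fin n)) k) ⧸ (Ideal.span {MvPolynomial.rename some f}).map (algebraMap (MvPolynomial (Option (Fin n)) k) (Localization.Away (MvPolynomial.X none : MvPolynomial (Option (Fin n)) k)))) :=
    IsLocalization.isDomain_of_le_nonZeroDivisors _ hM
  -- transport along the twist
  obtain ⟨Θ, -, -, -, hΘ⟩ := FilteredReesTwist.exists_quotient_twist w D f fh hfh hD0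
  have h1 : (Ideal.span {MvPolynomial.rename some f}).map (algebraMap (MvPolynomial (Option (Fin n)) k) (Localization.Away (MvPolynomial.X none : MvPolynomial (Option (Fin n)) k))) =
      Ideal.span {algebraMap (MvPolynomial (Option (Fin n)) k) (Localization.Away (MvPolynomial.X none : MvPolynomial (Option (Fin n)) k)) (MvPolynomial.rename some f)} := by
    rw [Ideal.map_span, Set.image_singleton]
  have h2 : (Ideal.span {fh}).map (algebraMap (MvPolynomial (Option (Fin n)) k) (Localization.Away (MvPolynomial.X none : MvPolynomial (Option (Fin n)) k))) = Ideal.span {algebraMap (MvPolynomial (Option (Fin n)) k) (Localization.Away (MvPolynomial.X none : MvPolynomial (Option (Fin n)) k)) fh} := by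
    rw [Ideal.map_span, Set.image_singleton]
  rw [h1] at hdom
  rw [h2]
  have hΘ' : Ideal.span {algebraMap (MvPolynomial (Option (Fin n)) k) (Localization.Away (MvPolynomial.X none : MvPolynomial (Option (Fin n)) k)) fh} =
      Ideal.map (Θ : Localization.Away (MvPolynomial.X none : MvPolynomial (Option (Fin n)) k) →+* Localization.Away (MvPolynomial.X none : MvPolynomial (Option (Fin n)) k)) (Ideal.span {algebraMap (MvPolynomial (Option (Fin n)) k) (Localization.Away (MvPolynomial.X none : MvPolynomial (Option (Fin n)) k)) (MvPolynomial.rename some f)}) := by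
    rw [← hΘ]
    rfl
  exact (MulEquiv.isDomain_iff (Ideal.quotientEquiv _ _ Θ hΘ').toMulEquiv).mp hdom

/-! ## `s̄` is a non-zero-divisor of `ℛ`, and `ℛ` is a domain -/

/-- **`s̄` is a non-zero-divisor of `ℛ = A/(f^h)`** when `f₀ ≠ 0`: if `s·a = f^h·b` then, setting `s = 0`, `f₀ · b|_{s=0} = 0`, so
`s ∣ b` and `a ∈ (f^h)`. [folklore] -/
theorem mk_X_none_mem_nonZeroDivisors (w : Fin n → ℕ) (D : ℕ) (f : MvPolynomial (Fin n) k) (fh : MvPolynomial (Option (Fin n)) k)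
    (hfh : fh = ∑ b ∈ f.support, MvPolynomial.monomial
      (Finsupp.mapDomain some b + Finsupp.single none (Finsupp.weight w b - D)) (MvPolynomial.coeff b f))
    (hD0 : ∀ m < D, MvPolynomial.weightedHomogeneousComponent w m f = 0) (hD : MvPolynomial.weightedHomogeneousComponent w D f ≠ 0) :
    Ideal.Quotient.mk (Ideal.span {fh}) (MvPolynomial.X none) ∈ nonZeroDivisors (MvPolynomial (Option (Fin n)) k ⧸ Ideal.span {fh}) := by
  rw [mem_nonZeroDivisors_iff_right]
  intro y hy
  obtain ⟨a, rfl⟩ := Ideal.Quotient.mk_surjective y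
  rw [← map_mul, Ideal.Quotient.eq_zero_iff_mem] at hy
  obtain ⟨b, hb⟩ := Ideal.mem_span_singleton'.mp hy
  -- set `s = 0`: `f₀ · b|₀ = 0`, so `b|₀ = 0`
  have h0 := congrArg (MvPolynomial.aeval (fun o : Option (Fin n) => o.elim (0 : MvPolynomial (Fin n) k) MvPolynomial.X)) hb
  rw [map_mul, map_mul, FilteredReesFibre.aeval_zero_fh w D f fh hfh hD0, MvPolynomial.aeval_X, Option.elim_none,
    mul_zero, mul_eq_zero] at h0
  have hb0 : MvPolynomial.aeval (fun o : Option (Fin n) => o.elim (0 : MvPolynomial (Fin n) k) MvPolynomial.X) b = 0 := by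
    rcases h0 with h0 | h0
    · exact h0
    · exact absurd h0 hD
  -- hence `s ∣ b`, `b = s b'`, and `a = b' f^h`
  have hsb : (MvPolynomial.X none : MvPolynomial (Option (Fin n)) k) ∣ b := by
    have h1 := FilteredReesFibre.sub_rename_aeval_zero_mem b
    rw [hb0, map_zero, sub_zero] at h1
    exact Ideal.mem_span_singleton.mp h1
  obtain ⟨b', rfl⟩ := hsb
  rw [Ideal.Quotient.eq_zero_iff_mem]
  refine Ideal.mem_span_singleton.mpr ⟨b', ?_⟩
  have h2 : (MvPolynomial.X none : MvPolynomial (Option (Fin n)) k) * (b' * fh) = MvPolynomial.X none * a := by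
    calc (MvPolynomial.X none : MvPolynomial (Option (Fin n)) k) * (b' * fh) = MvPolynomial.X none * b' * fh := by ring
      _ = a * MvPolynomial.X none := hb
      _ = MvPolynomial.X none * a := mul_comm _ _
  exact (mul_left_cancel₀ (MvPolynomial.X_ne_zero none) h2).symm.trans (mul_comm _ _)

/-- `f^h` is not a unit (its value at `s = 1` is `f`, a non-unit). [folklore] -/
theorem fh_not_isUnit (w : Fin n → ℕ) (D : ℕ) (f : MvPolynomial (Fin n) k) (fh : MvPolynomial (Option (Fin n)) k)
    (hfh : fh = ∑ b ∈ f.support, MvPolynomial.monomial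
      (Finsupp.mapDomain some b + Finsupp.single none (Finsupp.weight w b - D)) (MvPolynomial.coeff b f))
    (hfprime : (Ideal.span {f}).IsPrime) : ¬ IsUnit fh := by
  intro hu
  have h1 := hu.map (MvPolynomial.aeval (fun o : Option (Fin n) => o.elim (1 : MvPolynomial (Fin n) k) MvPolynomial.X))
  rw [FilteredReesCarrier.aeval_one_fh w D f fh hfh] at h1
  exact hfprime.ne_top (Ideal.eq_top_of_isUnit_mem _ (Ideal.mem_span_singleton_self f) h1)

/-- **`ℛ = k[X,s]/(f^h)` is a domain**: it embeds (`s̄` a non-zero-divisor) into its localisation `Aₛ/(f^h)·Aₛ`, a domain.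
[folklore] -/
theorem isDomain_rees (w : Fin n → ℕ) (D : ℕ) (f : MvPolynomial (Fin n) k) (fh : MvPolynomial (Option (Fin n)) k)
    (hfh : fh = ∑ b ∈ f.support, MvPolynomial.monomial
      (Finsupp.mapDomain some b + Finsupp.single none (Finsupp.weight w b - D)) (MvPolynomial.coeff b f))
    (hD0 : ∀ m < D, MvPolynomial.weightedHomogeneousComponent w m f = 0) (hD : MvPolynomial.weightedHomogeneousComponent w D f ≠ 0) (hfprime : (Ideal.span {f}).IsPrime) :
    IsDomain (MvPolynomial (Option (Fin n)) k ⧸ Ideal.span {fh}) := by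
  haveI := isDomain_away_quotient_fh w D f fh hfh hD0 hfprime
  have hM : Algebra.algebraMapSubmonoid (MvPolynomial (Option (Fin n)) k ⧸ Ideal.span {fh}) (Submonoid.powers (MvPolynomial.X none : MvPolynomial (Option (Fin n)) k)) ≤ nonZeroDivisors (MvPolynomial (Option (Fin n)) k ⧸ Ideal.span {fh}) := by
    rw [Algebra.algebraMapSubmonoid_powers]
    exact Submonoid.powers_le.mpr (mk_X_none_mem_nonZeroDivisors w D f fh hfh hD0 hD)
  exact Function.Injective.isDomain (algebraMap (MvPolynomial (Option (Fin n)) k ⧸ Ideal.span {fh}) (Localization.Away (MvPolynomial.X none : MvPolynomial (Option (Fin n)) k) ⧸ (Ideal.span {fh}).map (algebraMap (MvPolynomial (Option (Fin n)) k) (Localization.Away (MvPolynomial.X none : MvPolynomial (Option (Fin n)) k)))))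
    (IsLocalization.injective _ hM)

/-- `x̄ⱼ ≠ 0` in `ℛ` (else `f ∣ X_j` after `s = 1`). [folklore] -/
theorem mk_X_some_ne_zero (w : Fin n → ℕ) (D : ℕ) (f : MvPolynomial (Fin n) k) (fh : MvPolynomial (Option (Fin n)) k)
    (hfh : fh = ∑ b ∈ f.support, MvPolynomial.monomial
      (Finsupp.mapDomain some b + Finsupp.single none (Finsupp.weight w b - D)) (MvPolynomial.coeff b f))
    (hXne : ∀ j : Fin n, Ideal.Quotient.mk (Ideal.span {f}) (MvPolynomial.X j) ≠ 0) (j : Fin n) :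
    Ideal.Quotient.mk (Ideal.span {fh}) (MvPolynomial.X (some j)) ≠ 0 := by
  intro h
  obtain ⟨q, hq⟩ := Ideal.mem_span_singleton'.mp (Ideal.Quotient.eq_zero_iff_mem.mp h)
  have h1 := congrArg (MvPolynomial.aeval (fun o : Option (Fin n) => o.elim (1 : MvPolynomial (Fin n) k) MvPolynomial.X)) hq
  rw [map_mul, FilteredReesCarrier.aeval_one_fh w D f fh hfh, MvPolynomial.aeval_X, Option.elim_some] at h1
  exact hXne j (Ideal.Quotient.eq_zero_iff_mem.mpr (Ideal.mem_span_singleton'.mpr ⟨_, h1⟩))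

/-- `s̄ ≠ 0` in `ℛ` (else `f₀ · q|_{s=0} = 0`, `s ∣ q`, `f^h` a unit). [folklore] -/
theorem mk_X_none_ne_zero (w : Fin n → ℕ) (D : ℕ) (f : MvPolynomial (Fin n) k) (fh : MvPolynomial (Option (Fin n)) k)
    (hfh : fh = ∑ b ∈ f.support, MvPolynomial.monomial
      (Finsupp.mapDomain some b + Finsupp.single none (Finsupp.weight w b - D)) (MvPolynomial.coeff b f))
    (hD0 : ∀ m < D, MvPolynomial.weightedHomogeneousComponent w m f = 0) (hD : MvPolynomial.weightedHomogeneousComponent w D f ≠ 0) (hfprime : (Ideal.span {f}).IsPrime) :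
    Ideal.Quotient.mk (Ideal.span {fh}) (MvPolynomial.X none) ≠ 0 := by
  intro h
  obtain ⟨q, hq⟩ := Ideal.mem_span_singleton'.mp (Ideal.Quotient.eq_zero_iff_mem.mp h)
  have h0 := congrArg (MvPolynomial.aeval (fun o : Option (Fin n) => o.elim (0 : MvPolynomial (Fin n) k) MvPolynomial.X)) hq
  rw [map_mul, FilteredReesFibre.aeval_zero_fh w D f fh hfh hD0, MvPolynomial.aeval_X, Option.elim_none, mul_eq_zero] at h0
  have hq0 : MvPolynomial.aeval (fun o : Option (Fin n) => o.elim (0 : MvPolynomial (Fin n) k) MvPolynomial.X) q = 0 := by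
    rcases h0 with h0 | h0
    · exact h0
    · exact absurd h0 hD
  have hsq : (MvPolynomial.X none : MvPolynomial (Option (Fin n)) k) ∣ q := by
    have h1 := FilteredReesFibre.sub_rename_aeval_zero_mem q
    rw [hq0, map_zero, sub_zero] at h1
    exact Ideal.mem_span_singleton.mp h1
  obtain ⟨q', rfl⟩ := hsq
  have h2 : (MvPolynomial.X none : MvPolynomial (Option (Fin n)) k) * (q' * fh) = MvPolynomial.X none * 1 := by
    calc (MvPolynomial.X none : MvPolynomial (Option (Fin n)) k) * (q' * fh) = MvPolynomial.X none * q' * fh := by ring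
      _ = MvPolynomial.X none := hq
      _ = MvPolynomial.X none * 1 := (mul_one _).symm
  have h3 := mul_left_cancel₀ (MvPolynomial.X_ne_zero none) h2
  exact fh_not_isUnit w D f fh hfh hfprime (IsUnit.of_mul_eq_one q' (by rw [mul_comm]; exact h3))

/-! ## `T′♮ = ℛ[1/x̄_v^c]` -/

/-- **`T′♮` is a domain.** [folklore] -/
theorem isDomain_reesAway (w : Fin n → ℕ) (D : ℕ) (f : MvPolynomial (Fin n) k) (fh : MvPolynomial (Option (Fin n)) k)
    (hfh : fh = ∑ b ∈ f.support, MvPolynomial.monomial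
      (Finsupp.mapDomain some b + Finsupp.single none (Finsupp.weight w b - D)) (MvPolynomial.coeff b f))
    (hD0 : ∀ m < D, MvPolynomial.weightedHomogeneousComponent w m f = 0) (hD : MvPolynomial.weightedHomogeneousComponent w D f ≠ 0) (hfprime : (Ideal.span {f}).IsPrime)
    (hXne : ∀ j : Fin n, Ideal.Quotient.mk (Ideal.span {f}) (MvPolynomial.X j) ≠ 0) (v : Fin n) (c : ℕ) :
    IsDomain (Localization.Away (Ideal.Quotient.mk (Ideal.span {fh}) (MvPolynomial.X (some v)) ^ c)) := by
  haveI := isDomain_rees w D f fh hfh hD0 hD hfprime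
  exact IsLocalization.isDomain_localization
    (powers_le_nonZeroDivisors_of_noZeroDivisors (pow_ne_zero c (mk_X_some_ne_zero w D f fh hfh hXne v)))

/-- **`s̄/1 ≠ 0` in `T′♮`.** [folklore] -/
theorem algebraMap_mk_X_none_ne_zero (w : Fin n → ℕ) (D : ℕ) (f : MvPolynomial (Fin n) k)
    (fh : MvPolynomial (Option (Fin n)) k)
    (hfh : fh = ∑ b ∈ f.support, MvPolynomial.monomial
      (Finsupp.mapDomain some b + Finsupp.single none (Finsupp.weight w b - D)) (MvPolynomial.coeff b f))
    (hD0 : ∀ m < D, MvPolynomial.weightedHomogeneousComponent w m f = 0) (hD : MvPolynomial.weightedHomogeneousComponent w D f ≠ 0) (hfprime : (Ideal.span {f}).IsPrime)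
    (hXne : ∀ j : Fin n, Ideal.Quotient.mk (Ideal.span {f}) (MvPolynomial.X j) ≠ 0) (v : Fin n) (c : ℕ) :
    algebraMap (MvPolynomial (Option (Fin n)) k ⧸ Ideal.span {fh}) (Localization.Away (Ideal.Quotient.mk (Ideal.span {fh}) (MvPolynomial.X (some v)) ^ c)) (Ideal.Quotient.mk (Ideal.span {fh}) (MvPolynomial.X none)) ≠ 0 := by
  haveI := isDomain_rees w D f fh hfh hD0 hD hfprime
  intro h
  have hinj := IsLocalization.injective (Localization.Away (Ideal.Quotient.mk (Ideal.span {fh}) (MvPolynomial.X (some v)) ^ c))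
    (powers_le_nonZeroDivisors_of_noZeroDivisors (pow_ne_zero c (mk_X_some_ne_zero w D f fh hfh hXne v)))
  exact mk_X_none_ne_zero w D f fh hfh hD0 hD hfprime (hinj (by rw [h, map_zero]))

/-- **`T′♮` has characteristic `p`.** [folklore] -/
theorem charP_reesAway (p : ℕ) [CharP k p] (w : Fin n → ℕ) (D : ℕ) (f : MvPolynomial (Fin n) k)
    (fh : MvPolynomial (Option (Fin n)) k)
    (hfh : fh = ∑ b ∈ f.support, MvPolynomial.monomial
      (Finsupp.mapDomain some b + Finsupp.single none (Finsupp.weight w b - D)) (MvPolynomial.coeff b f))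
    (hD0 : ∀ m < D, MvPolynomial.weightedHomogeneousComponent w m f = 0) (hD : MvPolynomial.weightedHomogeneousComponent w D f ≠ 0) (hfprime : (Ideal.span {f}).IsPrime)
    (hXne : ∀ j : Fin n, Ideal.Quotient.mk (Ideal.span {f}) (MvPolynomial.X j) ≠ 0) (v : Fin n) (c : ℕ) :
    CharP (Localization.Away (Ideal.Quotient.mk (Ideal.span {fh}) (MvPolynomial.X (some v)) ^ c)) p := by
  haveI := isDomain_reesAway w D f fh hfh hD0 hD hfprime hXne v c
  exact charP_of_injective_algebraMap (algebraMap k (Localization.Away (Ideal.Quotient.mk (Ideal.span {fh}) (MvPolynomial.X (some v)) ^ c))).injective p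

/-- **`T′♮` is of finite type over `k`** (polynomial ring → quotient → localisation at one element). [folklore] -/
theorem finiteType_reesAway (fh : MvPolynomial (Option (Fin n)) k) (v : Fin n) (c : ℕ) :
    Algebra.FiniteType k (Localization.Away (Ideal.Quotient.mk (Ideal.span {fh}) (MvPolynomial.X (some v)) ^ c)) :=
  inferInstance

end Summit.ResolutionOfSingularities.ResolutionOfSingularities.Theorems.FInjectiveMacaulayfication.FilteredReesDomain

end
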